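import Literature.NumberTheory.Transcendental.RoySmallValueEstimatesAlgPointLiouvilleProofs
import Literature.NumberTheory.Transcendental.RoySmallValueEstimatesHomogenizationProofs
import Literature.NumberTheory.Transcendental.RoySmallValueLiouville
import HarnessLib

/-!
# Small value estimates at rational translates (Nguyen–Roy 2016) — proofs, XVIII: `Z ⊆ W_D` and the estimate for `Z ⊄ W_D`

Eighteenth proofs file towards `Literature.NumberTheory.Transcendental.nguyenRoy2016_thm_1` (Nguyen–Roy,
IJNT 12 (2016) = arXiv:1412.5163). Everything here is PROVED; no named facts. Given the homogenised
polynomials `P̃_D ∈ ℤ[X₀,X₁,X₂]_D` of Proposition 4 (file IX, `NguyenRoy.prop4`; here abstracted as a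
sequence `Pt D` with the four properties of that proposition from `D₀` on), §5 of the paper puts
`W_D = 𝒵(Φⁱ P̃_D : 0 ≤ i < 2⌊D^σ⌋)` and, for a zero-dimensional `Z ⊄ W_D`, uses a `Φʲ P̃_D`
(`0 ≤ j < 2⌊D^σ⌋`) not vanishing on `Z` (proof of Proposition 17: Liouville's inequality for the
product of its values over the points of `Z`, and Lemma 6 to compare the value at a point `α` with
the small value at `γ_k`, `0 ≤ j + k < 4⌊D^σ⌋`). With `V = AlgPt` (files XVI–XVII) this file
provides the corresponding fields of `NguyenRoy.EndgameData`:

* `Fpoly D i = Φⁱ P̃_D = τ_{(ir, sⁱ)} P̃_D ∈ ℂ[X]` (`Roy2013.tau`), `eval_tau` (`(τ_{u,v}P)(x) = P(τ̲x)`),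
  `IsIn Z D` ("`Z ⊆ W_D`": the `Φⁱ P̃_D`, `i < 2⌊D^σ⌋`, vanish at the normalised coordinates of
  `Z`), `eval_map_eq_zero_iff_of_mem_conj` (an integer polynomial vanishes at a conjugate iff it
  vanishes at `ap Z`) and **`isIn_of_mem`**;
* `pval F a = |F(ā)|/‖ā‖^{deg}` — the normalised absolute value of a form at a point of `ℙ²(ℂ)`
  (independent of the representative), `pval_le_pval_add` (Lemma 6 in this language);
* **`notIn`**: for `Z ⊄ W_D` there are `j < 2⌊D^σ⌋` and `v = pval (Φʲ P̃_D)` with `v > 0` on the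
  points of `Z`, `∑_{α ∈ Z} log v(α) ≥ −D h(Z)` (Liouville: the tree's
  `Roy2013.neg_logHeight_le_sum_log`, `c₇ = 0`) and
  `v(α) ≤ e^{−D^ν/2} + (D+2)³ e^{2D^β} dist(α, γ_k)` for `0 ≤ j + k < 4⌊D^σ⌋` (Lemma 6 +
  `|Φʲ P̃_D(γ_k)| = |P̃_D(γ_{j+k})| ≤ e^{−D^ν/2}`, `𝓛(Φʲ P̃_D) ≤ (D+1)² e^{2D^β}`).

## References

* [NguyenRoy2016] N. A. V. Nguyen, D. Roy, IJNT 12 (2016) 1273–1293 = arXiv:1412.5163, §5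
  (`W_D`, proof of Proposition 17), Lemma 6, Proposition 4.
* [Roy2013] D. Roy, Mathematika 59 (2013), Prop. 2.3 (2.2) (Liouville's inequality on `Z`).
-/

noncomputable section

open Height Module Matrix Finset MvPolynomial
open Literature.NumberTheory.Transcendental.Nesterenko
open Literature.NumberTheory.Transcendental.Roy2013 (CX)
open scoped Classical

namespace Literature.NumberTheory.Transcendental

namespace NguyenRoy

/-! ### Evaluating translated forms -/

/-- `(τ_{u,v} P)(x) = P(τ̲_{u,v} x)` with `τ̲_{u,v} x = (x₀, ux₀ + x₁, vx₂)` (`aeval` form).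
[cite: NguyenRoy2016, §2] -/
theorem aeval_tau (u v : ℂ) (x : Fin 3 → ℂ) (P : CX) :
    aeval x (Roy2013.tau u v P) = aeval (tauMat u v *ᵥ x) P := by
  have hmat : tauMat u v *ᵥ x = ![x 0, u * x 0 + x 1, v * x 2] := by
    ext a
    fin_cases a <;> simp [tauMat, Matrix.mulVec, dotProduct, Fin.sum_univ_three]
  rw [hmat, Roy2013.tau, ← AlgHom.comp_apply, MvPolynomial.comp_aeval]
  congr 2
  funext i
  fin_cases i <;> simp

/-- `(τ_{u,v} P)(x) = P(τ̲_{u,v} x)`. [cite: NguyenRoy2016, §2] -/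
theorem eval_tau (u v : ℂ) (x : Fin 3 → ℂ) (P : CX) :
    eval x (Roy2013.tau u v P) = eval (tauMat u v *ᵥ x) P := by
  have h := aeval_tau u v x P
  simp only [MvPolynomial.aeval_def, Algebra.algebraMap_self] at h
  exact h

/-- `τ̲_{(ir, sⁱ)} = τ̲ⁱ`. [cite: NguyenRoy2016, §2] -/
theorem tauMat_int_mul_eq_zpow (r : ℂ) {s : ℂ} (hs : s ≠ 0) (i : ℤ) :
    tauMat ((i : ℂ) * r) (s ^ i) = tauMat r s ^ i := by
  rw [tauMat_zpow r hs]
  ext a b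
  fin_cases a <;> fin_cases b <;> simp [tauMat, tauMatPow]

/-- Scaling the argument of a form of degree `D`: `F(c x) = c^D F(x)`. [folklore] -/
theorem eval_smul_of_isHomogeneous {F : CX} {D : ℕ} (hF : F.IsHomogeneous D) (c : ℂ) (x : V3) :
    eval (c • x) F = c ^ D * eval x F := by
  have h := aeval_mul_of_isHomogeneous hF c x
  simp only [Algebra.algebraMap_self, RingHom.id_apply] at h
  exact h

/-- The support of a ternary form of degree `D` has at most `(D+1)²` elements. [folklore] -/
theorem card_support_le_sq_of_isHomogeneous {R : Type*} [CommSemiring R] {Q : MvPolynomial (Fin 3) R}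
    {D : ℕ} (hQ : Q.IsHomogeneous D) : Q.support.card ≤ (D + 1) ^ 2 := by
  classical
  have hinj : Set.InjOn (fun e : Fin 3 →₀ ℕ => (e 0, e 1)) Q.support := by
    intro e he e' he' h
    simp only [Prod.mk.injEq] at h
    have hd := hQ (MvPolynomial.mem_support_iff.mp he)
    have hd' := hQ (MvPolynomial.mem_support_iff.mp he')
    rw [Finsupp.weight_apply, Finsupp.sum_fintype _ _ (by simp)] at hd hd'
    simp only [Pi.one_apply, smul_eq_mul, mul_one, Fin.sum_univ_three] at hd hd'
    ext a
    fin_cases a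
    · exact h.1
    · exact h.2
    · change e 2 = e' 2; omega
  have hsub : Q.support.image (fun e : Fin 3 →₀ ℕ => (e 0, e 1)) ⊆
      Finset.range (D + 1) ×ˢ Finset.range (D + 1) := by
    intro p hp
    obtain ⟨e, he, rfl⟩ := Finset.mem_image.mp hp
    have hd := hQ (MvPolynomial.mem_support_iff.mp he)
    rw [Finsupp.weight_apply, Finsupp.sum_fintype _ _ (by simp)] at hd
    simp only [Pi.one_apply, smul_eq_mul, mul_one, Fin.sum_univ_three] at hd
    simp only [Finset.mem_product, Finset.mem_range]
    omega
  calc Q.support.card = (Q.support.image fun e : Fin 3 →₀ ℕ => (e 0, e 1)).card :=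
        (Finset.card_image_of_injOn hinj).symm
    _ ≤ (Finset.range (D + 1) ×ˢ Finset.range (D + 1)).card := Finset.card_le_card hsub
    _ = (D + 1) ^ 2 := by simp [sq]

/-- `max |coeff| (Q : ℂ) = H(Q)` for an integer polynomial: `maxNorm (map Q) ≤ mvPolyHeight Q`.
[folklore] -/
theorem maxNorm_map_le_mvPolyHeight {σ : Type*} (Q : MvPolynomial σ ℤ) :
    maxNorm (map (Int.castRingHom ℂ) Q) ≤ mvPolyHeight Q := by
  unfold maxNorm
  have : ((map (Int.castRingHom ℂ) Q).support.sup fun γ => ‖(map (Int.castRingHom ℂ) Q).coeff γ‖₊) ≤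
      (mvPolyHeight Q : NNReal) := by
    refine Finset.sup_le fun γ hγ => ?_
    rw [coeff_map]
    have h1 : ‖(Int.castRingHom ℂ) (Q.coeff γ)‖₊ = ((Q.coeff γ).natAbs : NNReal) := by
      rw [eq_intCast, ← NNReal.coe_inj, coe_nnnorm, Complex.norm_intCast, NNReal.coe_natCast,
        Nat.cast_natAbs, Int.cast_abs]
    rw [h1]
    have hγ' : γ ∈ Q.support := by
      rw [MvPolynomial.mem_support_iff] at hγ ⊢
      intro h0; apply hγ; rw [coeff_map, h0, map_zero]
    exact_mod_cast Finset.le_sup (f := fun m => (Q.coeff m).natAbs) hγ'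
  exact_mod_cast this

/-- `𝓛(Q : ℂ) ≤ (D+1)² H(Q)` for an integer ternary form of degree `D`. [folklore] -/
theorem l1Norm_map_le_of_isHomogeneous {Q : MvPolynomial (Fin 3) ℤ} {D : ℕ} (hQ : Q.IsHomogeneous D) :
    l1Norm (map (Int.castRingHom ℂ) Q) ≤ ((D : ℝ) + 1) ^ 2 * mvPolyHeight Q := by
  have h1 := l1Norm_le_card_mul_maxNorm (map (Int.castRingHom ℂ) Q)
  have h2 : ((map (Int.castRingHom ℂ) Q).support.card : ℝ) ≤ ((D : ℝ) + 1) ^ 2 := by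
    have := card_support_le_sq_of_isHomogeneous (hQ.map (Int.castRingHom ℂ))
    exact_mod_cast this
  have h3 := maxNorm_map_le_mvPolyHeight Q
  have h4 : 0 ≤ maxNorm (map (Int.castRingHom ℂ) Q) := by
    unfold maxNorm; exact NNReal.coe_nonneg _
  calc l1Norm (map (Int.castRingHom ℂ) Q)
      ≤ (map (Int.castRingHom ℂ) Q).support.card * maxNorm (map (Int.castRingHom ℂ) Q) := h1
    _ ≤ ((D : ℝ) + 1) ^ 2 * mvPolyHeight Q := mul_le_mul h2 h3 h4 (by positivity)

/-! ### The normalised value of a form at a point -/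

/-- `|F(v)|/‖v‖^D` does not depend on the representative `v` of the point. [folklore] -/
theorem norm_eval_div_eq_of_mk_eq {F : CX} {D : ℕ} (hF : F.IsHomogeneous D) {v w : V3} (hv : v ≠ 0)
    (hw : w ≠ 0) (h : Projectivization.mk ℂ v hv = Projectivization.mk ℂ w hw) :
    ‖eval v F‖ / ‖v‖ ^ D = ‖eval w F‖ / ‖w‖ ^ D := by
  obtain ⟨c, rfl⟩ := (Projectivization.mk_eq_mk_iff' ℂ v w hv hw).mp h
  have hc : c ≠ 0 := by rintro rfl; exact hv (zero_smul _ _)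
  rw [eval_smul_of_isHomogeneous hF, norm_mul, norm_pow, norm_smul, mul_pow,
    mul_div_mul_left _ _ (pow_ne_zero _ (norm_ne_zero_iff.mpr hc))]

/-- The normalised absolute value `|F(ā)|/‖ā‖^D` of a form of degree `D` at a point `a ∈ ℙ²(ℂ)`.
[cite: NguyenRoy2016, §2 (values at points of norm 1)] -/
def pval (F : CX) (D : ℕ) (a : PPt) : ℝ := ‖eval a.rep F‖ / ‖a.rep‖ ^ D

/-- `pval` on a representative. [folklore] -/
theorem pval_mk {F : CX} {D : ℕ} (hF : F.IsHomogeneous D) {v : V3} (hv : v ≠ 0) :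
    pval F D (Projectivization.mk ℂ v hv) = ‖eval v F‖ / ‖v‖ ^ D := by
  unfold pval
  exact norm_eval_div_eq_of_mk_eq hF _ hv (Projectivization.mk_rep _)

/-- `0 ≤ pval`. [folklore] -/
theorem pval_nonneg (F : CX) (D : ℕ) (a : PPt) : 0 ≤ pval F D a := by
  unfold pval; positivity

/-- `pval` as the value at the unit representative. [folklore] -/
theorem pval_eq_norm_eval_unit {F : CX} {D : ℕ} (hF : F.IsHomogeneous D) {v : V3} (hv : v ≠ 0) :
    pval F D (Projectivization.mk ℂ v hv) = ‖eval (((‖v‖⁻¹ : ℝ) : ℂ) • v) F‖ := by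
  rw [pval_mk hF hv, eval_smul_of_isHomogeneous hF, norm_mul, norm_pow, Complex.norm_real,
    norm_inv, norm_norm, inv_pow, div_eq_inv_mul]

/-- The unit representative has norm `1`. [folklore] -/
theorem norm_unit_smul {v : V3} (hv : v ≠ 0) : ‖(((‖v‖⁻¹ : ℝ) : ℂ) • v)‖ = 1 := by
  rw [norm_smul, Complex.norm_real, norm_inv, norm_norm, inv_mul_cancel₀ (norm_ne_zero_iff.mpr hv)]

/-- **Lemma 6 for points**: `pval F a ≤ pval F b + D 𝓛(F) dist(a, b)`.
[cite: NguyenRoy2016, Lemma 6] -/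
theorem pval_le_pval_add {F : CX} {D : ℕ} (hF : F.IsHomogeneous D) (a b : PPt) :
    pval F D a ≤ pval F D b + D * l1Norm F * pdist a b := by
  have ha := a.rep_nonzero
  have hb := b.rep_nonzero
  have h := norm_eval_le_norm_eval_add (norm_unit_smul ha) (norm_unit_smul hb) hF
  rw [← Projectivization.mk_rep a, ← Projectivization.mk_rep b, pval_eq_norm_eval_unit hF ha,
    pval_eq_norm_eval_unit hF hb, pdist_mk]
  have hd : projDist ((((‖a.rep‖⁻¹ : ℝ) : ℂ)) • a.rep) ((((‖b.rep‖⁻¹ : ℝ) : ℂ)) • b.rep) =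
      projDist a.rep b.rep := by
    rw [projDist_smul_left _ (by
        exact_mod_cast inv_ne_zero (norm_ne_zero_iff.mpr ha)),
      PhilipponMain.projDist_smul_right _ (by
        exact_mod_cast inv_ne_zero (norm_ne_zero_iff.mpr hb))]
  rw [hd] at h
  exact h

/-! ### Values of integer forms at conjugate points -/

/-- The normalised coordinates of a conjugate: `nv [φ(ap P)] = φ ∘ ap P`. [folklore] -/
theorem AlgPt.nv_embPt (P : AlgPt) (φ : Kp P.1 →ₐ[ℚ] ℂ) :
    nv (P.embPt φ) = fun j => φ (ap P.1 j) := by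
  rw [embPt, (nv_mk _).1]
  have hpiv : pivot (fun j => φ (ap P.1 j)) = piv P.1 := by
    rw [show (fun j => φ (ap P.1 j)) = fun j => φ.toRingHom (ap P.1 j) from rfl,
      pivot_map φ.toRingHom (ap P.1)]
    have h2 := pivot_map (algebraMap (Kp P.1) ℂ) (ap P.1)
    have h3 : (fun j => (algebraMap (Kp P.1) ℂ) (ap P.1 j)) = nv P.1 := funext fun j => rfl
    rw [h3] at h2
    rw [← h2, piv, nv]
    conv_rhs => rw [← smul_nrm P.1.rep_nonzero]
    rw [pivot_smul (apply_pivot_ne_zero P.1.rep_nonzero)]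
  funext j
  simp only [nrm]
  rw [hpiv, ap_piv, map_one, div_one]

/-- A ring homomorphism commutes with the evaluation of an INTEGER polynomial:
`f(Q(x)) = Q(f ∘ x)`. [folklore] -/
theorem ringHom_aeval_int {R S ι : Type*} [CommRing R] [CommRing S] (f : R →+* S) (x : ι → R)
    (Q : MvPolynomial ι ℤ) :
    f (aeval x Q) = eval (fun j => f (x j)) (map (Int.castRingHom S) Q) := by
  rw [MvPolynomial.aeval_def, MvPolynomial.eval₂_comp_left, eval_map]
  congr 1
  exact RingHom.ext_int _ _

/-- `Q(x)` for an integer polynomial as the evaluation of its complexification. [folklore] -/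
theorem aeval_eq_eval_map {ι : Type*} (x : ι → ℂ) (Q : MvPolynomial ι ℤ) :
    aeval x Q = eval x (map (Int.castRingHom ℂ) Q) := by
  rw [eval_map, MvPolynomial.aeval_def, algebraMap_int_eq]

/-- An integer polynomial evaluated at a conjugate: `Q(nv q) = φ(Q(ap P))`. [folklore] -/
theorem AlgPt.eval_map_nv_embPt (P : AlgPt) (φ : Kp P.1 →ₐ[ℚ] ℂ) (Q : MvPolynomial (Fin 3) ℤ) :
    eval (nv (P.embPt φ)) (map (Int.castRingHom ℂ) Q) = φ (aeval (ap P.1) Q) := by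
  rw [P.nv_embPt φ]
  exact (ringHom_aeval_int φ.toRingHom (ap P.1) Q).symm

/-- **An integer polynomial vanishes at a conjugate of `P` iff it vanishes at `ap P`.**
[cite: NguyenRoy2016, §4 (Z is defined over ℚ)] -/
theorem AlgPt.eval_map_eq_zero_iff_of_mem_conj (P : AlgPt) (Q : MvPolynomial (Fin 3) ℤ) {q : PPt}
    (hq : q ∈ P.conj) : eval (nv q) (map (Int.castRingHom ℂ) Q) = 0 ↔ aeval (ap P.1) Q = 0 := by
  obtain ⟨φ, -, rfl⟩ := Finset.mem_image.mp hq
  rw [P.eval_map_nv_embPt φ Q, map_eq_zero_iff φ φ.toRingHom.injective]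

/-! ### `W_D` and `Z ⊆ W_D` -/

section IsIn

variable (ξ η : ℂ) (r s : ℚ) (σ₀ β ν : ℝ) (Pt : ℕ → MvPolynomial (Fin 3) ℤ)

/-- `Φⁱ P̃_D = τ_{(ir, sⁱ)} P̃_D ∈ ℂ[X₀, X₁, X₂]`. [cite: NguyenRoy2016, §5 (W_D)] -/
def Fpoly (D i : ℕ) : CX :=
  Roy2013.tau ((i : ℂ) * (r : ℂ)) ((s : ℂ) ^ i) (map (Int.castRingHom ℂ) (Pt D))

/-- `Z ⊆ W_D = 𝒵(Φⁱ P̃_D : 0 ≤ i < 2⌊D^σ⌋)`, phrased through the integer models `Q` of the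
`Φⁱ P̃_D` (which exist by Proposition 4, and are unique): every such `Q`, `i < 2⌊D^σ⌋`, vanishes at
the coordinates `ap Z` (equivalently at every conjugate). [cite: NguyenRoy2016, §5 (W_D)] -/
def IsIn (Z : AlgPt) (D : ℕ) : Prop :=
  ∀ i : ℕ, i < 2 * ⌊(D : ℝ) ^ σ₀⌋₊ → ∀ Q : MvPolynomial (Fin 3) ℤ,
    map (Int.castRingHom ℂ) Q = Fpoly r s Pt D i → aeval (ap Z.1) Q = 0

/-- The four properties of `P̃_D` delivered by Proposition 4 (`NguyenRoy.prop4`) at the level `D`.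
[cite: NguyenRoy2016, Proposition 4] -/
def PropsAt (D : ℕ) : Prop :=
  (Pt D).IsHomogeneous D ∧ Pt D ≠ 0 ∧ ∀ i : ℕ, i < 4 * ⌊(D : ℝ) ^ σ₀⌋₊ →
    (∃ Q : MvPolynomial (Fin 3) ℤ, Q.IsHomogeneous D ∧
        map (Int.castRingHom ℂ) Q = Fpoly r s Pt D i ∧
        (mvPolyHeight Q : ℝ) ≤ Real.exp (2 * (D : ℝ) ^ β)) ∧
      ‖aeval ![(1 : ℂ), ξ + (i : ℂ) * (r : ℂ), η * (s : ℂ) ^ i] (Pt D)‖ ≤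
        Real.exp (-(D : ℝ) ^ ν / 2)

/-- **`P̃_D` is not divisible by `X₀` nor by `X₂`**, recorded through the support witnesses of
Proposition 4 (`NguyenRoy.prop4`: a monomial without `X₀` and a monomial without `X₂`).
[cite: NguyenRoy2016, Proposition 4 ("P̃_D is not divisible by X₀ nor by X₂")] -/
def SuppAt (D : ℕ) : Prop :=
  (∃ e ∈ (Pt D).support, e 0 = 0) ∧ (∃ e ∈ (Pt D).support, e 2 = 0)

variable {ξ η r s σ₀ β ν Pt}

/-- A monomial without `X_k` in the support prevents divisibility by `X_k` (over `ℂ`). [folklore] -/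
theorem not_X_dvd_map_of_mem_support {F : MvPolynomial (Fin 3) ℤ} {k : Fin 3} {e : Fin 3 →₀ ℕ}
    (he : e ∈ F.support) (hek : e k = 0) : ¬ (X k : CX) ∣ map (Int.castRingHom ℂ) F := by
  intro h
  rw [X_dvd_iff_modMonomial_eq_zero] at h
  have hnot : ¬ Finsupp.single k 1 ≤ e := fun hle => by
    have := hle k
    rw [Finsupp.single_eq_same, hek] at this
    exact Nat.not_succ_le_zero 0 this
  have h1 := coeff_modMonomial_of_not_le (map (Int.castRingHom ℂ) F) hnot
  rw [h, coeff_zero, coeff_map, eq_intCast] at h1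
  exact (mem_support_iff.mp he) (by exact_mod_cast h1.symm)

/-- `X₀ ∤ P̃_D` and `X₂ ∤ P̃_D` from `SuppAt`. [cite: NguyenRoy2016, Proposition 4] -/
theorem not_dvd_of_suppAt {D : ℕ} (h : SuppAt Pt D) :
    ¬ (X 0 : CX) ∣ map (Int.castRingHom ℂ) (Pt D) ∧ ¬ (X 2 : CX) ∣ map (Int.castRingHom ℂ) (Pt D) := by
  obtain ⟨⟨e, he, he0⟩, ⟨e', he', he'2⟩⟩ := h
  exact ⟨not_X_dvd_map_of_mem_support he he0, not_X_dvd_map_of_mem_support he' he'2⟩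

/-- **`Z ⊆ W_D` only depends on the points** (`EndgameData.isIn_of_mem`): if `Z` and `Z'` have a
common conjugate and `Z ⊆ W_D` then `Z' ⊆ W_D` (the integer models vanish at a conjugate iff they
vanish at `ap`). [cite: NguyenRoy2016, §5] -/
theorem isIn_of_mem (D : ℕ) (Z Z' : AlgPt) (b : PPt) (hb : b ∈ Z.conj) (hb' : b ∈ Z'.conj)
    (h : IsIn r s σ₀ Pt Z D) : IsIn r s σ₀ Pt Z' D := by
  intro i hi Q hQ
  have h1 := h i hi Q hQ
  rw [← Z.eval_map_eq_zero_iff_of_mem_conj Q hb, Z'.eval_map_eq_zero_iff_of_mem_conj Q hb'] at h1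
  exact h1

/-- The integer model of `Φⁱ P̃_D` is unique. [folklore] -/
theorem int_model_unique {Q Q' : MvPolynomial (Fin 3) ℤ}
    (h : map (Int.castRingHom ℂ) Q = map (Int.castRingHom ℂ) Q') : Q = Q' :=
  MvPolynomial.map_injective _ (RingHom.injective_int _) h

/-- With the data of Proposition 4 at level `D`, `Z ⊆ W_D` is the vanishing of the `Φⁱ P̃_D`,
`i < 2⌊D^σ⌋`, at the normalised coordinates of `Z`. [cite: NguyenRoy2016, §5 (W_D)] -/
theorem isIn_iff {D : ℕ} (hD : PropsAt ξ η r s σ₀ β ν Pt D) (Z : AlgPt) :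
    IsIn r s σ₀ Pt Z D ↔ ∀ i : ℕ, i < 2 * ⌊(D : ℝ) ^ σ₀⌋₊ → eval (nv Z.1) (Fpoly r s Pt D i) = 0 := by
  constructor
  · intro h i hi
    obtain ⟨⟨Q, -, hQmap, -⟩, -⟩ := hD.2.2 i (by omega)
    rw [← hQmap, Z.eval_map_eq_zero_iff_of_mem_conj Q Z.self_mem_conj]
    exact h i hi Q hQmap
  · intro h i hi Q hQ
    rw [← Z.eval_map_eq_zero_iff_of_mem_conj Q Z.self_mem_conj, hQ]
    exact h i hi

/-! ### The estimate for `Z ⊄ W_D` -/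

/-- `‖γ̲_k‖ ≥ 1` (its first coordinate is `1`). [folklore] -/
theorem one_le_norm_gvec (ξ η r s : ℂ) (k : ℤ) : 1 ≤ ‖gvec ξ η r s k‖ := by
  calc (1 : ℝ) = ‖gvec ξ η r s k 0‖ := by simp [gvec]
    _ ≤ _ := norm_le_pi_norm _ 0

/-- `(Φʲ P̃_D)(γ̲_k) = P̃_D(γ̲_{j+k})`. [cite: NguyenRoy2016, §2 (τγ_i = γ_{i+1})] -/
theorem eval_gvec_Fpoly (hs : s ≠ 0) (D j : ℕ) (k : ℤ) :
    eval (gvec ξ η (r : ℂ) (s : ℂ) k) (Fpoly r s Pt D j) =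
      eval (gvec ξ η (r : ℂ) (s : ℂ) ((j : ℤ) + k)) (map (Int.castRingHom ℂ) (Pt D)) := by
  have hsC : (s : ℂ) ≠ 0 := by exact_mod_cast hs
  rw [Fpoly, eval_tau]
  have : tauMat (((j : ℕ) : ℂ) * (r : ℂ)) ((s : ℂ) ^ (j : ℕ)) = tauMat (r : ℂ) (s : ℂ) ^ (j : ℤ) := by
    rw [← tauMat_int_mul_eq_zpow (r : ℂ) hsC (j : ℤ)]
    simp
  rw [this, tauMat_zpow_mulVec_gvec ξ η (r : ℂ) hsC]

/-- The value `|P̃_D(γ̲_n)| ≤ e^{−D^ν/2}` in the `gvec` language. [cite: NguyenRoy2016, Prop. 4] -/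
theorem norm_eval_gvec_le {D : ℕ} (hD : PropsAt ξ η r s σ₀ β ν Pt D) {n : ℕ}
    (hn : n < 4 * ⌊(D : ℝ) ^ σ₀⌋₊) :
    ‖eval (gvec ξ η (r : ℂ) (s : ℂ) (n : ℤ)) (map (Int.castRingHom ℂ) (Pt D))‖ ≤
      Real.exp (-(D : ℝ) ^ ν / 2) := by
  have h := (hD.2.2 n hn).2
  have hg : gvec ξ η (r : ℂ) (s : ℂ) (n : ℤ) = ![(1 : ℂ), ξ + (n : ℂ) * (r : ℂ), η * (s : ℂ) ^ n] := by
    simp [gvec]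
  rwa [hg, ← aeval_eq_eval_map]

/-- **The estimate for `Z ⊄ W_D`** (`EndgameData.notIn` with `c₇ = 0`): some `Φʲ P̃_D`,
`0 ≤ j < 2⌊D^σ⌋`, has normalised values `v = pval (Φʲ P̃_D)` on the points of `Z` with `v > 0`,
`∑_{α ∈ Z} log v(α) ≥ −D h(Z)` (Liouville) and `v(α) ≤ e^{−D^ν/2} + (D+2)³ e^{2D^β} dist(α, γ_k)`
whenever `0 ≤ j + k < 4⌊D^σ⌋` (Lemma 6). [cite: NguyenRoy2016, §5 (proof of Proposition 17)] -/
theorem notIn (hs : s ≠ 0) {D : ℕ} (hD : PropsAt ξ η r s σ₀ β ν Pt D) (Zv : AlgPt)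
    (hnot : ¬ IsIn r s σ₀ Pt Zv D) :
    ∃ j : ℤ, 0 ≤ j ∧ j < 2 * (⌊(D : ℝ) ^ σ₀⌋₊ : ℕ) ∧ ∃ v : PPt → ℝ, (∀ a ∈ Zv.conj, 0 < v a) ∧
      -(0 * D * Zv.conj.card + D * Zv.ht) ≤ ∑ a ∈ Zv.conj, Real.log (v a) ∧
      ∀ a ∈ Zv.conj, ∀ k : ℤ, 0 ≤ j + k → j + k < 4 * (⌊(D : ℝ) ^ σ₀⌋₊ : ℕ) →
        v a ≤ Real.exp (-(D : ℝ) ^ ν / 2) +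
          ((D : ℝ) + 2) ^ 3 * Real.exp (2 * (D : ℝ) ^ β) * pdist a (gamP ξ η (r : ℂ) (s : ℂ) k) := by
  -- a non-vanishing integer model `Q` of some `Φʲ P̃_D`
  obtain ⟨j, hj, Q, hQmap, haQ⟩ : ∃ j : ℕ, j < 2 * ⌊(D : ℝ) ^ σ₀⌋₊ ∧ ∃ Q : MvPolynomial (Fin 3) ℤ,
      map (Int.castRingHom ℂ) Q = Fpoly r s Pt D j ∧ aeval (ap Zv.1) Q ≠ 0 := by
    by_contra hcon
    push Not at hcon
    exact hnot hcon
  obtain ⟨⟨Q', hQhom', hQmap', hQht'⟩, -⟩ := hD.2.2 j (by omega)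
  obtain rfl : Q = Q' := int_model_unique (hQmap.trans hQmap'.symm)
  have hQhom : Q.IsHomogeneous D := hQhom'
  have hQht : (mvPolyHeight Q : ℝ) ≤ Real.exp (2 * (D : ℝ) ^ β) := hQht'
  have hFhom : (map (Int.castRingHom ℂ) Q).IsHomogeneous D := hQhom.map _
  -- `pval` through the normalised coordinates
  have hpv : ∀ q : PPt, pval (map (Int.castRingHom ℂ) Q) D q =
      ‖eval (nv q) (map (Int.castRingHom ℂ) Q)‖ / ‖nv q‖ ^ D := fun q => by
    conv_lhs => rw [← mk_nv q]
    exact pval_mk hFhom (nv_ne_zero q)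
  -- the values
  refine ⟨(j : ℤ), by exact_mod_cast Nat.zero_le j, by exact_mod_cast hj,
    pval (map (Int.castRingHom ℂ) Q) D, ?_, ?_, ?_⟩
  · -- positivity on the conjugates
    intro a ha
    obtain ⟨φ, -, rfl⟩ := Finset.mem_image.mp ha
    rw [hpv, Zv.eval_map_nv_embPt]
    exact div_pos (norm_pos_iff.mpr ((map_ne_zero φ.toRingHom).mpr haQ))
      (pow_pos (norm_pos_iff.mpr (nv_ne_zero _)) _)
  · -- Liouville
    have ha0 : ap Zv.1 ≠ 0 := fun h => by
      have := congrFun h (piv Zv.1)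
      rw [ap_piv] at this
      exact one_ne_zero this
    have hL := Roy2013.neg_logHeight_le_sum_log (K := Kp Zv.1) hQhom ha0 haQ
    have hht : (D : ℝ) * logHeight (ap Zv.1) = D * Zv.ht := by
      rw [AlgPt.ht, Zv.habs_eq_logHeight_ap]
      have hd : (0 : ℝ) < Zv.deg := by exact_mod_cast Zv.one_le_deg
      field_simp
    -- reindex the sum over the embeddings by the conjugates
    have key : -((D : ℝ) * logHeight (ap Zv.1)) ≤
        ∑ a ∈ Zv.conj, Real.log (pval (map (Int.castRingHom ℂ) Q) D a) := by
      refine hL.trans_eq ?_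
      rw [AlgPt.conj, Finset.sum_image fun φ _ ψ _ h => Zv.embPt_injective h]
      refine Fintype.sum_equiv (RingHom.equivRatAlgHom) _ _ fun τ => ?_
      rw [hpv, Zv.eval_map_nv_embPt, Zv.nv_embPt]
      rfl
    rw [hht] at key
    linarith
  · -- Lemma 6 against `γ_k`
    intro a ha k hjk hjk'
    obtain ⟨n, hn⟩ : ∃ n : ℕ, (n : ℤ) = (j : ℤ) + k := ⟨((j : ℤ) + k).toNat, Int.toNat_of_nonneg hjk⟩
    have hn4 : n < 4 * ⌊(D : ℝ) ^ σ₀⌋₊ := by omega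
    have h6 := pval_le_pval_add hFhom a (gamP ξ η (r : ℂ) (s : ℂ) k)
    -- the value at `γ_k`
    have hγ : pval (map (Int.castRingHom ℂ) Q) D (gamP ξ η (r : ℂ) (s : ℂ) k) ≤
        Real.exp (-(D : ℝ) ^ ν / 2) := by
      rw [gamP, pval_mk hFhom, hQmap, eval_gvec_Fpoly hs, ← hn]
      have h1 := norm_eval_gvec_le hD hn4
      have h2 : (1 : ℝ) ≤ ‖gvec ξ η (r : ℂ) (s : ℂ) k‖ ^ D := one_le_pow₀ (one_le_norm_gvec _ _ _ _ k)
      exact (div_le_self (norm_nonneg _) h2).trans h1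
    -- the length of `Φʲ P̃_D`
    have hL1 : (D : ℝ) * l1Norm (map (Int.castRingHom ℂ) Q) ≤
        ((D : ℝ) + 2) ^ 3 * Real.exp (2 * (D : ℝ) ^ β) := by
      have h1 := l1Norm_map_le_of_isHomogeneous hQhom
      have hD0 : (0 : ℝ) ≤ D := Nat.cast_nonneg _
      have hexp : (0 : ℝ) ≤ Real.exp (2 * (D : ℝ) ^ β) := (Real.exp_pos _).le
      calc (D : ℝ) * l1Norm (map (Int.castRingHom ℂ) Q) ≤ D * (((D : ℝ) + 1) ^ 2 * mvPolyHeight Q) :=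
            mul_le_mul_of_nonneg_left h1 hD0
        _ ≤ D * (((D : ℝ) + 1) ^ 2 * Real.exp (2 * (D : ℝ) ^ β)) := by
            apply mul_le_mul_of_nonneg_left _ hD0
            exact mul_le_mul_of_nonneg_left hQht (by positivity)
        _ = (D * ((D : ℝ) + 1) ^ 2) * Real.exp (2 * (D : ℝ) ^ β) := by ring
        _ ≤ ((D : ℝ) + 2) ^ 3 * Real.exp (2 * (D : ℝ) ^ β) := by
            apply mul_le_mul_of_nonneg_right _ hexp
            nlinarith
    have hd0 : 0 ≤ pdist a (gamP ξ η (r : ℂ) (s : ℂ) k) := pdist_nonneg _ _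
    calc pval (map (Int.castRingHom ℂ) Q) D a
        ≤ pval (map (Int.castRingHom ℂ) Q) D (gamP ξ η (r : ℂ) (s : ℂ) k) +
            D * l1Norm (map (Int.castRingHom ℂ) Q) * pdist a (gamP ξ η (r : ℂ) (s : ℂ) k) := h6
      _ ≤ Real.exp (-(D : ℝ) ^ ν / 2) +
          ((D : ℝ) + 2) ^ 3 * Real.exp (2 * (D : ℝ) ^ β) * pdist a (gamP ξ η (r : ℂ) (s : ℂ) k) :=
          add_le_add hγ (mul_le_mul_of_nonneg_right hL1 hd0)

end IsIn

end NguyenRoy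

end Literature.NumberTheory.Transcendental

end
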